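import Summits.CriticalPhenomena.PercolationContinuityZ3.Theorems.PercNearOneGluingNoHeavyLowerTailTformRef3Certificate
import HarnessLib

/-!
# `NoHeavyLowerTail` (stmt-CriticalPhenomena-4575) — the crux from the REF3 certificate at every informative gluing instance

Support file (prover `prim-hp-5`, hull-port cell, T-form calculus, gen 7; `--supports stmt-CriticalPhenomena-4575`).  No definitions,
no named facts, no sorries.  `Theorems.noHeavyLowerTail_of_informativeGluedChampion` reduces the crux to the informative gluing step
(champion `q`, light non-relay `B` with `2 ≤ |B|`, a member with a positive pair, gluing `B` dethrones `q`, the set-induction hypothesis);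
`Theorems.gluedSet_lsp_of_ref3` discharges that step from the two-event comparison REF3(y, p, D): a member `y` with a positive pair, a
champion `p` of `u` = `w` without the pairs at `y`, a set `D` of relays dominated by `q` in `u`, and `μ(C_D ∩ G_p) ≤ μ(C_D ∩ G_q)`.  Hence:

* `noHeavyLowerTail_of_ref3Certificate` — `NoHeavyLowerTail` follows if every informative gluing instance admits SOME `y, p, D` with REF3.

This is the typed residual of the T-form line after gen 7 (seat memo OBSERVER-SET.md §18–20): a pure comparison of glued lightness between
the champion `q` and a sub-champion `p` on the cylinder `C_D`; census 0 violations (seat lab y32/y33; ttrl2 request line 487).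
-/

noncomputable section

namespace Summit.CriticalPhenomena.PercolationContinuityZ3.Theorems

open MeasureTheory Set Literature.Probability.LatticeModels Literature.Probability.Percolation
open scoped Classical BigOperators

/-- **The crux from REF3.**  If every informative gluing instance `(w, A, B, q, c, j)` (with the set-induction hypothesis) admits a member
`y ∈ B` with a positive pair, a champion `p` of `w` without the pairs at `y`, and a set `D` of relays dominated by `q` there, such that
`μ(C_D ∩ G_p) ≤ μ(C_D ∩ G_q)`, then `NoHeavyLowerTail`. [cite: KozmaNitzan2024, Lemma 5 and Thm. 4 (pp. 13–14)] -/
theorem noHeavyLowerTail_of_ref3Certificate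
    (hRef : ∀ (n : ℕ) (w : Sym2 (Fin n) → unitInterval) (A B : Finset (Fin n)) (q c : Fin n) (j : ℕ),
      (∀ (n' : ℕ) (w' : Sym2 (Fin n') → unitInterval) (A' B' : Finset (Fin n')) (q' c' : Fin n') (j' : ℕ),
        (Finset.univ.filter fun e : Sym2 (Fin n') => w' e ≠ 0).card < (Finset.univ.filter fun e : Sym2 (Fin n) => w e ≠ 0).card →
        q' ∈ A' → c' ∈ A' → B'.Nonempty → (∀ m ∈ B', m ∉ A') →
        (∀ a ∈ A', (prodBernoulli w').real {ω : BondConfig (Fin n') | (A'.filter fun x => ω ∈ openConn a x).card ≤ j'} ≤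
          (prodBernoulli w').real {ω : BondConfig (Fin n') | (A'.filter fun x => ω ∈ openConn q' x).card ≤ j'}) →
        (prodBernoulli w').real {ω : BondConfig (Fin n') | (∀ m ∈ B', ω ∉ openConn q' m) ∧
            1 ≤ (A'.filter fun z => ∃ m ∈ B', ω ∈ openConn m z).card ∧ (A'.filter fun z => ∃ m ∈ B', ω ∈ openConn m z).card ≤ j'} +
          (prodBernoulli w').real {ω : BondConfig (Fin n') | ¬ 1 ≤ (A'.filter fun z => ∃ m ∈ B', ω ∈ openConn m z).card ∧
            (A'.filter fun z => ω ∈ openConn c' z).card ≤ j'} ≤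
        (prodBernoulli w').real {ω : BondConfig (Fin n') | (∀ m ∈ B', ω ∉ openConn q' m) ∧ (A'.filter fun z => ω ∈ openConn q' z).card ≤ j'}) →
      q ∈ A → c ∈ A → 2 ≤ B.card → (∀ y ∈ B, y ∉ A) →
      (∀ a ∈ A, (prodBernoulli w).real {ω : BondConfig (Fin n) | (A.filter fun x => ω ∈ openConn a x).card ≤ j} ≤
        (prodBernoulli w).real {ω : BondConfig (Fin n) | (A.filter fun x => ω ∈ openConn q x).card ≤ j}) →
      (∀ y ∈ B, (prodBernoulli w).real {ω : BondConfig (Fin n) | (A.filter fun x => ω ∈ openConn q x).card ≤ j} <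
        (prodBernoulli w).real {ω : BondConfig (Fin n) | (A.filter fun x => ω ∈ openConn y x).card ≤ j}) →
      (∃ y ∈ B, ∃ v, v ≠ y ∧ w s(y, v) ≠ 0) →
      (∃ a ∈ A, (prodBernoulli w).real {ω : BondConfig (Fin n) |
          ((∃ m ∈ B, ω ∈ openConn q m) → (A.filter fun z => ∃ m ∈ B, ω ∈ openConn m z).card ≤ j) ∧
            ((∀ m ∈ B, ω ∉ openConn q m) → (A.filter fun z => ω ∈ openConn q z).card ≤ j)} <
        (prodBernoulli w).real {ω : BondConfig (Fin n) |
          ((∃ m ∈ B, ω ∈ openConn a m) → (A.filter fun z => ∃ m ∈ B, ω ∈ openConn m z).card ≤ j) ∧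
            ((∀ m ∈ B, ω ∉ openConn a m) → (A.filter fun z => ω ∈ openConn a z).card ≤ j)}) →
      ∃ y ∈ B, (∃ v, v ≠ y ∧ w s(y, v) ≠ 0) ∧ ∃ p ∈ A,
        (∀ a ∈ A, (prodBernoulli fun e => if e ∈ {e : Sym2 (Fin n) | y ∉ e} then w e else 0).real
            {ξ : BondConfig (Fin n) | (A.filter fun z => ξ ∈ openConn a z).card ≤ j} ≤
          (prodBernoulli fun e => if e ∈ {e : Sym2 (Fin n) | y ∉ e} then w e else 0).real
            {ξ : BondConfig (Fin n) | (A.filter fun z => ξ ∈ openConn p z).card ≤ j}) ∧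
        ∃ D : Finset (Fin n),
          (∀ r ∈ D, r ∈ A ∧ (prodBernoulli fun e => if e ∈ {e : Sym2 (Fin n) | y ∉ e} then w e else 0).real
              {ξ : BondConfig (Fin n) | (A.filter fun z => ξ ∈ openConn r z).card ≤ j} ≤
            (prodBernoulli fun e => if e ∈ {e : Sym2 (Fin n) | y ∉ e} then w e else 0).real
              {ξ : BondConfig (Fin n) | (A.filter fun z => ξ ∈ openConn q z).card ≤ j}) ∧
          (prodBernoulli w).real ({ω : BondConfig (Fin n) | ∀ r ∈ D, s(y, r) ∉ ω} ∩ {ω : BondConfig (Fin n) |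
              ((∃ m ∈ B, ω ∈ openConn p m) → (A.filter fun z => ∃ m ∈ B, ω ∈ openConn m z).card ≤ j) ∧
                ((∀ m ∈ B, ω ∉ openConn p m) → (A.filter fun z => ω ∈ openConn p z).card ≤ j)}) ≤
            (prodBernoulli w).real ({ω : BondConfig (Fin n) | ∀ r ∈ D, s(y, r) ∉ ω} ∩ {ω : BondConfig (Fin n) |
              ((∃ m ∈ B, ω ∈ openConn q m) → (A.filter fun z => ∃ m ∈ B, ω ∈ openConn m z).card ≤ j) ∧
                ((∀ m ∈ B, ω ∉ openConn q m) → (A.filter fun z => ω ∈ openConn q z).card ≤ j)})) :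
    Summit.CriticalPhenomena.PercolationContinuityZ3.Theses.PercNearOneGluing.NoHeavyLowerTail := by
  refine noHeavyLowerTail_of_informativeGluedChampion fun n w A B q c j ih hq hc hB hBA hch hl hpos hinf => ?_
  have ih' : ∀ (n' : ℕ) (w' : Sym2 (Fin n') → unitInterval) (A' B' : Finset (Fin n')) (q' c' : Fin n') (j' : ℕ),
      (Finset.univ.filter fun e : Sym2 (Fin n') => w' e ≠ 0).card < (Finset.univ.filter fun e : Sym2 (Fin n) => w e ≠ 0).card →
      q' ∈ A' → c' ∈ A' → B'.Nonempty → (∀ m ∈ B', m ∉ A') →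
      (∀ a ∈ A', (prodBernoulli w').real {ω : BondConfig (Fin n') | (A'.filter fun x => ω ∈ openConn a x).card ≤ j'} ≤
        (prodBernoulli w').real {ω : BondConfig (Fin n') | (A'.filter fun x => ω ∈ openConn q' x).card ≤ j'}) →
      (prodBernoulli w').real {ω : BondConfig (Fin n') | (∀ m ∈ B', ω ∉ openConn q' m) ∧
          1 ≤ (A'.filter fun z => ∃ m ∈ B', ω ∈ openConn m z).card ∧ (A'.filter fun z => ∃ m ∈ B', ω ∈ openConn m z).card ≤ j'} +
        (prodBernoulli w').real {ω : BondConfig (Fin n') | ¬ 1 ≤ (A'.filter fun z => ∃ m ∈ B', ω ∈ openConn m z).card ∧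
          (A'.filter fun z => ω ∈ openConn c' z).card ≤ j'} ≤
      (prodBernoulli w').real {ω : BondConfig (Fin n') | (∀ m ∈ B', ω ∉ openConn q' m) ∧ (A'.filter fun z => ω ∈ openConn q' z).card ≤ j'} :=
    fun n' w' A' B' q' c' j' hlt hq' hc' hB' hBA' hch' => ih n' w' A' B' q' c' j' (Or.inl hlt) hq' hc' hB' hBA' hch'
  obtain ⟨y, hyB, hy, p, hpA, hpch, D, hD, hcmp⟩ := hRef n w A B q c j ih' hq hc hB hBA hch hl hpos hinf
  exact gluedSet_lsp_of_ref3 w A B D y p q c j ih' hq hc hBA hyB hB hy hpA hpch hD hcmp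

end Summit.CriticalPhenomena.PercolationContinuityZ3.Theorems

end
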